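import Summits.QuantumFields.YangMills.Theorems.BalabanUVNodesN19ExpectationCurrencyTwoConstants
import Summits.QuantumFields.YangMills.Theorems.BalabanUVNodesN19ExpectationCurrencyAtScheme

/-!
# YM-DAG node N19 (= NE7 proper) — THE EXPECTATION CURRENCY OF THE NODE's DECL TARGET, III: TWO CONSTANTS, AT THE SCHEME — matching modulo constants with
# remainder `δ_K` on the REAL segment `|t| ≤ l₀` ALONE pays `|⟨∏os⟩_{K+1} − ⟨∏os⟩_K| ≤ (8·e^{1+l₀}∕l₀)·vol·δ_K·(1 + log⁺ (2·vol·δ_K)⁻¹)` — the LINEAR-LOG price,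
# in place of the √-road's `4·vol·δ_K∕l₀ + 2·√(vol·δ_K)` (p477267); hence `ExpectCauchyRate S (δ·(1 + log⁺ δ⁻¹))`, the continuum limit of the expectations
# WITH AN EXPLICIT RATE whenever `Σ δ_K(1 + log⁺ δ_K⁻¹) < ∞`, and which remainders pay (geometric ones; `(K+1)⁻²`, where the √-road fails)

Cell `pub-ymgap`, HUMAN RULING D-0062 (Track A), R141 (C) wider-strategy seat `pub-ymgap-dag-n19-e` (strategy s3 = ALTERNATIVE CURRENCY), sixth module of the
seat, sibling of the analysis half `…Theorems.BalabanUVNodesN19ExpectationCurrencyTwoConstants` (two constants ⇒ `|∫Y dν − ∫X dμ| ≤ 4·e^{1+l₀B}·ε·(1 + log⁺ ε⁻¹)∕l₀`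
for `ε`-close cgf's on a real segment), filed right after it (400-line rule).  Route `Summits/QuantumFields/YangMills/Theses/BalabanUVNodes.lean` rev 15, cluster
item K3′ «SpineGivenEndpointR12» (stmt-QuantumFields-19908); filed `--supports` that item `--as helper` (it proves no registered stub).  COUNT-NEUTRAL: bookkeeping BY
NAME over the tree's scheme objects (`T4GenFunBounds.schemeZ` ∕ `prodObs` ∕ `gibbsMeasure` ∕ `genFun_schemeZ_eq_cgf` ∕ `expectAt_eq_integral_gibbs`,
`T4CauchySum.abs_genFun_succ_sub_le`, `T4VarianceMatching.ExpectCauchyRate` ∕ `hasContinuumLimit_of_expectCauchyRate`, `Spine.NE7.Target`, the √-road's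
`mul_nonneg_of_matchingModConstants` ∕ `summable_sqrt_of_le_geometric`) + elementary real analysis (Mathlib `Real.posLog`, `Real.log_le_rpow_div`, p-series);
NOT a discharge claim.

WHAT IS KERNEL-CHECKED (0 `def`, 0 `sorry`).
* §3 AT THE SCHEME [bookkeeping over the √-road's plumbing]: `abs_expectAt_succ_sub_le_linlog_of_matchingModConstants` — `MatchingModConstants vol l₀ δ (schemeZ S os)`,
  `0 < l₀` ⇒ `|S.expectAt (K+1) os − S.expectAt K os| ≤ (8·e^{1+l₀}∕l₀)·(vol·δ_K)·(1 + log⁺ (2·vol·δ_K)⁻¹)` for EVERY `K` (the analysis half for the product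
  observables `F_K`, `F_{K+1}` — bounded by `1` — under the two Gibbs measures, `ε = 2·vol·δ_K`, `B = 1`) · `linlog_mul_le` (arithmetic: the volume factor
  separates, `Real.posLog_mul`) · `expectCauchyRate_linlog_of_matchingModConstants` (ONE remainder `δ` for all strings, `0 ≤ vol_os`, NO boundedness clause on
  `vol_os·δ` ⇒ `T4VarianceMatching.ExpectCauchyRate S (K ↦ δ_K·(1 + log⁺ δ_K⁻¹))`, constant `C_os = (8e^{1+l₀}∕l₀)·vol_os·(1 + log⁺ (2vol_os)⁻¹)`) ·
  `hasContinuumLimit_of_matchingModConstants_linlog` (`… ∧ Σ δ_K(1 + log⁺ δ_K⁻¹) < ∞ ⇒ Missing.HasContinuumLimit S`, BY NAME) ·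
  `abs_expectAt_sub_lim_le_linlog_of_matchingModConstants` (THE RATE: a limit `E` with `|S.expectAt K os − E| ≤ Σ_j d_{K+j}`, `d_K` the display — for geometric
  `δ_K ≤ C·θ^K` the tail is `O(K·θ^K)` against the √-road's `O(θ^{K∕2})`) · `expectCauchyRate_linlog_of_target` (`Spine.NE7.Target` BY NAME, common remainder).
* §4 [folklore] which remainders pay: `mul_posLog_inv_le_two_sqrt` (`x·log⁺ x⁻¹ ≤ 2√x`: the linear-log summability hypothesis is WEAKER than the √-road's) ·
  `summable_linlog_of_summable_sqrt` · `summable_linlog_of_le_geometric` (the GEOMETRIC remainders of the budget road p453434 pay) · `linlog_summable_inv_sq_witness`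
  (`δ_K = (K+1)⁻²`: `Σ δ_K(1 + log⁺ δ_K⁻¹) < ∞` although `Σ √δ_K = Σ (K+1)⁻¹ = ∞` — the √-road's displayed failure example is COVERED by this road).

HONEST FRAMING.  NE7 ∕ NE7b ∕ NE7c are NOT PRINTED ([Balaban1987RG1]–[Balaban1989LargeFieldII] bound ONE run uniformly in `ε`; printed template [King1986]
(3.10)–(3.13) pp. 656–657, context only) and NOT PROVED; `Target` ∕ `MatchingModConstants` occur as HYPOTHESES only; nothing of Bałaban's is asserted or
instantiated; N19 is NOT discharged; K3′ is NOT claimed; Track A count unmoved (typed 28∕28 · discharged 5∕27 · A 5∕28).  The summability `Σ δ_K(1 + log⁺ δ_K⁻¹) < ∞`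
is an EXTRA hypothesis beyond `Target`'s `Σ δ_K < ∞` (displayed, never smuggled): strictly weaker than the √-road's `Σ√δ_K < ∞`, true for geometric remainders and
for `δ_K = (K+1)⁻²`, false for e.g. `δ_K = 1∕((K+2)·log²(K+2))` — the qualitative limit needs only `Target` (node U0, `T4VitaliStep` ∕ `T4CauchySum`, unchanged); whether
the RATE `Σ_{j≥K} δ_j` (no logarithm) is available from `Target` alone is NOT decided here (the one-step logarithm is sharp for the disc ∕ diameter class, the sum
is another matter).  One finite four-torus at fixed ε, rung (B)+1 — NOT infinite volume, NOT OS on ℝ⁴, NOT a mass gap, NOT Clay.  THEOREMS ONLY; 0 sorry; standard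
axioms.  No decl below carries a cite tag.
-/

set_option autoImplicit false

noncomputable section

open Set Metric Filter Topology MeasureTheory ProbabilityTheory
open scoped BigOperators

namespace Summit.QuantumFields.YangMills.BalabanUVNodes.N19ExpectationCurrencyTwoConstantsAtScheme

open Literature.MathematicalPhysics.QuantumFieldTheory.Balaban1983to89
open T4CauchySum (MatchingModConstants genFun)
open T4GenFunBounds (schemeZ prodObs)
open Missing (TorusScheme HasContinuumLimit)
open Summit.QuantumFields.BalabanUV.T4Continuum.Spine
open Summit.QuantumFields.YangMills.BalabanUVNodes.N19ExpectationCurrencyAtScheme (mul_nonneg_of_matchingModConstants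
  summable_sqrt_of_le_geometric)
open Summit.QuantumFields.YangMills.BalabanUVNodes.N19ExpectationCurrencyTwoConstants (abs_integral_sub_integral_le_linlog_of_cgf_close)

/-! ## §3 At the scheme: N19's DECL target in the observable currency, linear-log price [bookkeeping] -/

section Scheme

variable {G : Type*} [GaugeGroup G] [MeasurableSpace G] [RegularGaugeGroup G] [HaarData G] {O : Type*}
  (S : TorusScheme G O) (hβ : ∀ K, 0 ≤ S.β K) (hm : ∀ K o, Measurable (S.obs K o))
  (h1 : ∀ K o U, |S.obs K o U| ≤ 1)
include hβ hm h1

/-- **N19's TARGET PAYS THE OBSERVABLE INCREMENTS AT THE LINEAR-LOG PRICE.**  If the dressed partition functions of a string `os` match modulo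
constants with remainder `δ` at radius `l₀ > 0` on the REAL segment (`T4CauchySum.MatchingModConstants vol l₀ δ (schemeZ S os)` — N19's DECL target
without its summability conjunct), then for every `K`
`|S.expectAt (K+1) os − S.expectAt K os| ≤ (8·e^{1+l₀}∕l₀)·(vol·δ_K)·(1 + log⁺ (2·vol·δ_K)⁻¹)`:
the analysis half's `abs_integral_sub_integral_le_linlog_of_cgf_close` for the product observables `F_K`, `F_{K+1}` (bounded by `1`,
`T4GenFunBounds.abs_prodObs_le_one`) under the two Gibbs measures, whose cgf's are `genFun (schemeZ S os) K` (`genFun_schemeZ_eq_cgf`) and are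
`2·vol·δ_K`-close on `|t| ≤ l₀` (`T4CauchySum.abs_genFun_succ_sub_le`), and whose means are the expectations (`expectAt_eq_integral_gibbs`). [folklore] -/
theorem abs_expectAt_succ_sub_le_linlog_of_matchingModConstants {vol l₀ : ℝ} {δ : ℕ → ℝ} (hl₀ : 0 < l₀) (os : List O)
    (hM : MatchingModConstants vol l₀ δ (schemeZ S os)) (K : ℕ) :
    |S.expectAt (K + 1) os - S.expectAt K os| ≤
      8 * Real.exp (1 + l₀) / l₀ * (vol * δ K) * (1 + Real.posLog (2 * (vol * δ K))⁻¹) := by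
  haveI hP : ∀ K, IsProbabilityMeasure (T4GenFunBounds.gibbsMeasure (G := G) (S.P K) (S.β K)) := fun K =>
    T4GenFunBounds.isProbabilityMeasure_gibbsMeasure (G := G) (S.P K) (hβ K)
  have hvd : 0 ≤ vol * δ K := mul_nonneg_of_matchingModConstants hl₀.le hM K
  have hmeas : ∀ K, AEMeasurable (prodObs S K os) (T4GenFunBounds.gibbsMeasure (S.P K) (S.β K)) := fun K =>
    (T4GenFunBounds.measurable_prodObs S hm K os).aemeasurable
  have hbd : ∀ K, ∀ᵐ U ∂(T4GenFunBounds.gibbsMeasure (G := G) (S.P K) (S.β K)), |prodObs S K os U| ≤ 1 := fun K =>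
    Eventually.of_forall (T4GenFunBounds.abs_prodObs_le_one S h1 K os)
  have hε : ∀ t : ℝ, |t| < l₀ →
      |cgf (prodObs S (K + 1) os) (T4GenFunBounds.gibbsMeasure (S.P (K + 1)) (S.β (K + 1))) t -
        cgf (prodObs S K os) (T4GenFunBounds.gibbsMeasure (S.P K) (S.β K)) t| ≤ 2 * (vol * δ K) := fun t ht => by
    rw [← T4GenFunBounds.genFun_schemeZ_eq_cgf S hβ hm h1, ← T4GenFunBounds.genFun_schemeZ_eq_cgf S hβ hm h1]
    exact T4CauchySum.abs_genFun_succ_sub_le hM hl₀.le K ht.le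
  have key := abs_integral_sub_integral_le_linlog_of_cgf_close (hmeas K) (hmeas (K + 1)) (hbd K) (hbd (K + 1)) hl₀
    (by positivity) hε
  rw [← T4GenFunBounds.expectAt_eq_integral_gibbs S hβ, ← T4GenFunBounds.expectAt_eq_integral_gibbs S hβ, mul_one] at key
  refine key.trans (le_of_eq ?_)
  ring

omit hβ hm h1 in
/-- Arithmetic: the volume factor separates from the remainder in the linear-log display — for `0 ≤ v`, `0 ≤ d`,
`(v·d)·(1 + log⁺ (2·v·d)⁻¹) ≤ v·(1 + log⁺ (2v)⁻¹) · (d·(1 + log⁺ d⁻¹))` (`Real.posLog_mul`). [folklore] -/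
theorem linlog_mul_le {v d : ℝ} (hv : 0 ≤ v) (hd : 0 ≤ d) :
    v * d * (1 + Real.posLog (2 * (v * d))⁻¹) ≤ v * (1 + Real.posLog (2 * v)⁻¹) * (d * (1 + Real.posLog d⁻¹)) := by
  have hsplit : Real.posLog (2 * (v * d))⁻¹ ≤ Real.posLog (2 * v)⁻¹ + Real.posLog d⁻¹ := by
    rw [show (2 * (v * d))⁻¹ = (2 * v)⁻¹ * d⁻¹ by rw [← mul_inv, mul_assoc]]
    exact Real.posLog_mul
  have ha : 0 ≤ Real.posLog (2 * v)⁻¹ := Real.posLog_nonneg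
  have hb : 0 ≤ Real.posLog d⁻¹ := Real.posLog_nonneg
  have hvd : 0 ≤ v * d := mul_nonneg hv hd
  calc v * d * (1 + Real.posLog (2 * (v * d))⁻¹) ≤ v * d * (1 + (Real.posLog (2 * v)⁻¹ + Real.posLog d⁻¹)) := by gcongr
    _ ≤ v * d * ((1 + Real.posLog (2 * v)⁻¹) * (1 + Real.posLog d⁻¹)) := by
        apply mul_le_mul_of_nonneg_left _ hvd; nlinarith
    _ = v * (1 + Real.posLog (2 * v)⁻¹) * (d * (1 + Real.posLog d⁻¹)) := by ring

/-- **ONE REMAINDER FOR ALL STRINGS ⇒ `ExpectCauchyRate S (δ·(1 + log⁺ δ⁻¹))`.**  If every string's dressed partition functions match modulo constants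
at the common radius `l₀ > 0` with the COMMON remainder `δ` and a volume factor `vol_os ≥ 0` (NO boundedness clause on `vol_os·δ` is needed), then
`T4VarianceMatching.ExpectCauchyRate S (K ↦ δ_K·(1 + log⁺ δ_K⁻¹))` with the constant `C_os = (8e^{1+l₀}∕l₀)·vol_os·(1 + log⁺ (2vol_os)⁻¹)`. [folklore] -/
theorem expectCauchyRate_linlog_of_matchingModConstants {l₀ : ℝ} {δ : ℕ → ℝ} (hl₀ : 0 < l₀)
    (hM : ∀ os : List O, ∃ vol : ℝ, 0 ≤ vol ∧ MatchingModConstants vol l₀ δ (schemeZ S os)) :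
    T4VarianceMatching.ExpectCauchyRate S fun K => δ K * (1 + Real.posLog (δ K)⁻¹) := by
  intro os
  obtain ⟨vol, hvol, hMos⟩ := hM os
  refine ⟨8 * Real.exp (1 + l₀) / l₀ * (vol * (1 + Real.posLog (2 * vol)⁻¹)), fun K => ?_⟩
  have h := abs_expectAt_succ_sub_le_linlog_of_matchingModConstants S hβ hm h1 hl₀ os hMos K
  refine h.trans ?_
  have hc : 0 ≤ 8 * Real.exp (1 + l₀) / l₀ := by positivity
  rcases hvol.eq_or_lt with hv0 | hvpos
  · rw [← hv0]; simp
  · have hδ : 0 ≤ δ K := by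
      have h0 := mul_nonneg_of_matchingModConstants hl₀.le hMos K
      by_contra hneg
      nlinarith [mul_pos hvpos (neg_pos.2 (not_le.mp hneg))]
    have key := linlog_mul_le hvol hδ
    calc 8 * Real.exp (1 + l₀) / l₀ * (vol * δ K) * (1 + Real.posLog (2 * (vol * δ K))⁻¹)
        = 8 * Real.exp (1 + l₀) / l₀ * (vol * δ K * (1 + Real.posLog (2 * (vol * δ K))⁻¹)) := by ring
      _ ≤ 8 * Real.exp (1 + l₀) / l₀ * (vol * (1 + Real.posLog (2 * vol)⁻¹) * (δ K * (1 + Real.posLog (δ K)⁻¹))) :=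
        mul_le_mul_of_nonneg_left key hc
      _ = 8 * Real.exp (1 + l₀) / l₀ * (vol * (1 + Real.posLog (2 * vol)⁻¹)) * (δ K * (1 + Real.posLog (δ K)⁻¹)) := by
        ring

/-- **… AND `Σ δ_K(1 + log⁺ δ_K⁻¹) < ∞` ⇒ THE CONTINUUM LIMIT OF ALL JOINT EXPECTATIONS** (`T4VarianceMatching.hasContinuumLimit_of_expectCauchyRate` BY
NAME).  The extra summability is DISPLAYED: it holds for geometric remainders and for `δ_K = (K+1)⁻²` (§4) and is NOT implied by `Summable δ`. [folklore] -/
theorem hasContinuumLimit_of_matchingModConstants_linlog {l₀ : ℝ} {δ : ℕ → ℝ} (hl₀ : 0 < l₀)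
    (hM : ∀ os : List O, ∃ vol : ℝ, 0 ≤ vol ∧ MatchingModConstants vol l₀ δ (schemeZ S os))
    (hδ : Summable fun K => δ K * (1 + Real.posLog (δ K)⁻¹)) : HasContinuumLimit S :=
  T4VarianceMatching.hasContinuumLimit_of_expectCauchyRate S hδ
    (expectCauchyRate_linlog_of_matchingModConstants S hβ hm h1 hl₀ hM)

/-- **THE RATE TO THE LIMIT.**  Under `MatchingModConstants vol l₀ δ (schemeZ S os)` (`0 < l₀`), if the displayed increments
`d_K = (8e^{1+l₀}∕l₀)·(vol·δ_K)·(1 + log⁺ (2vol·δ_K)⁻¹)` are summable, the string's expectations converge to a limit `E` with `|S.expectAt K os − E| ≤ Σ_j d_{K+j}`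
for every `K` (Mathlib `cauchySeq_of_dist_le_of_summable` ∕ `dist_le_tsum_of_dist_le_of_tendsto`); for geometric `δ_K ≤ C·θ^K` the tail is `O(K·θ^K)`, against
the √-road's `O(θ^{K∕2})`. [folklore] -/
theorem abs_expectAt_sub_lim_le_linlog_of_matchingModConstants {vol l₀ : ℝ} {δ : ℕ → ℝ} (hl₀ : 0 < l₀) (os : List O)
    (hM : MatchingModConstants vol l₀ δ (schemeZ S os))
    (hs : Summable fun K => 8 * Real.exp (1 + l₀) / l₀ * (vol * δ K) * (1 + Real.posLog (2 * (vol * δ K))⁻¹)) :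
    ∃ E : ℝ, Tendsto (fun K => S.expectAt K os) atTop (𝓝 E) ∧
      ∀ K, |S.expectAt K os - E| ≤
        ∑' j, 8 * Real.exp (1 + l₀) / l₀ * (vol * δ (K + j)) * (1 + Real.posLog (2 * (vol * δ (K + j)))⁻¹) := by
  have hd : ∀ K, dist (S.expectAt K os) (S.expectAt (K + 1) os) ≤
      (fun K => 8 * Real.exp (1 + l₀) / l₀ * (vol * δ K) * (1 + Real.posLog (2 * (vol * δ K))⁻¹)) K := fun K => by
    rw [Real.dist_eq, abs_sub_comm]
    exact abs_expectAt_succ_sub_le_linlog_of_matchingModConstants S hβ hm h1 hl₀ os hM K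
  have hc : CauchySeq fun K => S.expectAt K os := cauchySeq_of_dist_le_of_summable _ hd hs
  obtain ⟨E, hE⟩ := cauchySeq_tendsto_of_complete hc
  exact ⟨E, hE, fun K => by
    rw [← Real.dist_eq]
    exact dist_le_tsum_of_dist_le_of_tendsto _ hd hs hE K⟩

/-- **N19's DECL TARGET PAYS `ExpectCauchyRate S (δ·(1 + log⁺ δ⁻¹))`.**  If every string carries `Spine.NE7.Target vol_os l₀ δ (schemeZ S os)` (matching
modulo constants AND `Summable δ`) with a COMMON remainder `δ` at the common radius `l₀ > 0` and `0 ≤ vol_os`, then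
`T4VarianceMatching.ExpectCauchyRate S (K ↦ δ_K·(1 + log⁺ δ_K⁻¹))` — only the matching conjunct is used.  `Target` is a HYPOTHESIS (NOT PRINTED, NOT proved).
[folklore] -/
theorem expectCauchyRate_linlog_of_target {l₀ : ℝ} {δ : ℕ → ℝ} (hl₀ : 0 < l₀)
    (hT : ∀ os : List O, ∃ vol : ℝ, 0 ≤ vol ∧ NE7.Target vol l₀ δ (schemeZ S os)) :
    T4VarianceMatching.ExpectCauchyRate S fun K => δ K * (1 + Real.posLog (δ K)⁻¹) := by
  refine expectCauchyRate_linlog_of_matchingModConstants S hβ hm h1 hl₀ fun os => ?_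
  obtain ⟨vol, hvol, hM, -⟩ := hT os
  exact ⟨vol, hvol, hM⟩

end Scheme

/-! ## §4 Which remainders pay: `Σ δ_K(1 + log⁺ δ_K⁻¹) < ∞` [folklore] -/

section Summability

/-- `x·log⁺ x⁻¹ ≤ 2·√x` for `x ≥ 0` (`log y ≤ 2·y^{1∕2}`, Mathlib `Real.log_le_rpow_div`, at `y = x⁻¹`). Hence the linear-log road's summability
hypothesis is WEAKER than the √-road's. [folklore] -/
theorem mul_posLog_inv_le_two_sqrt {x : ℝ} (hx : 0 ≤ x) : x * Real.posLog x⁻¹ ≤ 2 * Real.sqrt x := by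
  rcases hx.eq_or_lt with hx0 | hxpos
  · rw [← hx0]; simp
  rcases le_or_gt 1 x with hx1 | hx1
  · have h0 : Real.posLog x⁻¹ = 0 := by
      rw [Real.posLog_eq_zero_iff, abs_of_nonneg (inv_nonneg.2 hx)]
      exact inv_le_one_of_one_le₀ hx1
    rw [h0, mul_zero]
    positivity
  · have hinv : 1 ≤ x⁻¹ := (one_le_inv₀ hxpos).2 hx1.le
    rw [Real.posLog_eq_log (by rwa [abs_of_nonneg (inv_nonneg.2 hx)])]
    have hlog : Real.log x⁻¹ ≤ (x⁻¹) ^ (1 / 2 : ℝ) / (1 / 2) := Real.log_le_rpow_div (inv_nonneg.2 hx) (by norm_num)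
    have hsq : (x⁻¹) ^ (1 / 2 : ℝ) = (Real.sqrt x)⁻¹ := by
      rw [Real.inv_rpow hx, ← Real.sqrt_eq_rpow]
    rw [hsq] at hlog
    have hsx : 0 < Real.sqrt x := Real.sqrt_pos.2 hxpos
    calc x * Real.log x⁻¹ ≤ x * ((Real.sqrt x)⁻¹ / (1 / 2)) := mul_le_mul_of_nonneg_left hlog hx
      _ = 2 * (x / Real.sqrt x) := by field_simp
      _ = 2 * Real.sqrt x := by rw [Real.div_sqrt]

/-- `Σ δ_K < ∞` and `Σ √δ_K < ∞` (`δ ≥ 0`) ⇒ `Σ δ_K(1 + log⁺ δ_K⁻¹) < ∞` (termwise `δ(1 + log⁺ δ⁻¹) ≤ δ + 2√δ`). [folklore] -/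
theorem summable_linlog_of_summable_sqrt {δ : ℕ → ℝ} (hδ : ∀ K, 0 ≤ δ K) (h1 : Summable δ)
    (h2 : Summable fun K => Real.sqrt (δ K)) : Summable fun K => δ K * (1 + Real.posLog (δ K)⁻¹) := by
  refine Summable.of_nonneg_of_le (fun K => mul_nonneg (hδ K) (add_nonneg zero_le_one Real.posLog_nonneg))
    (fun K => ?_) (h1.add (h2.mul_left 2))
  have h := mul_posLog_inv_le_two_sqrt (hδ K)
  nlinarith

/-- The GEOMETRIC remainders of the budget road pay: `0 ≤ δ_K ≤ C·θ^K`, `0 ≤ θ < 1` ⇒ `Σ δ_K(1 + log⁺ δ_K⁻¹) < ∞` (the sibling's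
`summable_sqrt_of_le_geometric` BY NAME). [folklore] -/
theorem summable_linlog_of_le_geometric {δ : ℕ → ℝ} {C θ : ℝ} (hδ : ∀ K, 0 ≤ δ K) (hθ : 0 ≤ θ) (hθ1 : θ < 1)
    (hle : ∀ K, δ K ≤ C * θ ^ K) : Summable fun K => δ K * (1 + Real.posLog (δ K)⁻¹) :=
  summable_linlog_of_summable_sqrt hδ
    (Summable.of_nonneg_of_le hδ hle ((summable_geometric_of_lt_one hθ hθ1).mul_left C))
    (summable_sqrt_of_le_geometric hδ hθ hθ1 hle)

/-- **WITNESS: the linear-log road covers the √-road's failure example.**  For `δ_K = (K+1)⁻²`: `Σ δ_K(1 + log⁺ δ_K⁻¹) = Σ (1 + 2log(K+1))∕(K+1)² < ∞`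
(termwise `≤ 5·(K+1)^{−3∕2}` by `log y ≤ 2√y`), whereas `Σ √δ_K = Σ (K+1)⁻¹ = ∞`. [folklore] -/
theorem linlog_summable_inv_sq_witness :
    (Summable fun K : ℕ => ((K : ℝ) + 1)⁻¹ ^ 2 * (1 + Real.posLog (((K : ℝ) + 1)⁻¹ ^ 2)⁻¹)) ∧
      ¬ Summable fun K : ℕ => Real.sqrt (((K : ℝ) + 1)⁻¹ ^ 2) := by
  constructor
  · -- termwise: `δ_K·log⁺ δ_K⁻¹ = 2(K+1)⁻²·log(K+1)` and `log (K+1) ≤ 4(K+1)^{1/4}` ⇒ term `≤ (K+1)⁻² + 8(K+1)^{−7/4}`, two p-series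
    have hK : ∀ K : ℕ, (0 : ℝ) < (K : ℝ) + 1 := fun K => by positivity
    have hterm : ∀ K : ℕ, ((K : ℝ) + 1)⁻¹ ^ 2 * (1 + Real.posLog (((K : ℝ) + 1)⁻¹ ^ 2)⁻¹) ≤
        (((K : ℝ) + 1) ^ (2 : ℝ))⁻¹ + 8 * (((K : ℝ) + 1) ^ (7 / 4 : ℝ))⁻¹ := by
      intro K
      set y : ℝ := (K : ℝ) + 1 with hy
      have hy1 : 1 ≤ y := by rw [hy]; linarith [(Nat.cast_nonneg K : (0 : ℝ) ≤ K)]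
      have hy0 : 0 < y := hK K
      have e1 : (y⁻¹ ^ 2)⁻¹ = y ^ 2 := by rw [inv_pow, inv_inv]
      have hpl : Real.posLog (y⁻¹ ^ 2)⁻¹ = 2 * Real.log y := by
        rw [e1, Real.posLog_eq_log (by rw [abs_of_pos (by positivity)]; nlinarith), Real.log_pow]; norm_num
      have hlog : Real.log y ≤ y ^ (1 / 4 : ℝ) / (1 / 4) := Real.log_le_rpow_div hy0.le (by norm_num)
      have hlog' : Real.log y ≤ 4 * y ^ (1 / 4 : ℝ) := by linarith
      have e2 : y⁻¹ ^ 2 = (y ^ (2 : ℝ))⁻¹ := by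
        rw [Real.rpow_two, inv_pow]
      have e3 : (y ^ (2 : ℝ))⁻¹ * y ^ (1 / 4 : ℝ) = (y ^ (7 / 4 : ℝ))⁻¹ := by
        rw [← Real.rpow_neg hy0.le, ← Real.rpow_neg hy0.le, ← Real.rpow_add hy0]; norm_num
      rw [hpl, e2]
      have hy2 : 0 < (y ^ (2 : ℝ))⁻¹ := by positivity
      calc (y ^ (2 : ℝ))⁻¹ * (1 + 2 * Real.log y) ≤ (y ^ (2 : ℝ))⁻¹ * (1 + 2 * (4 * y ^ (1 / 4 : ℝ))) := by gcongr
        _ = (y ^ (2 : ℝ))⁻¹ + 8 * ((y ^ (2 : ℝ))⁻¹ * y ^ (1 / 4 : ℝ)) := by ring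
        _ = (y ^ (2 : ℝ))⁻¹ + 8 * (y ^ (7 / 4 : ℝ))⁻¹ := by rw [e3]
    have hs1 : Summable fun K : ℕ => (((K : ℝ) + 1) ^ (2 : ℝ))⁻¹ := by
      have h := (Real.summable_nat_rpow_inv.2 (by norm_num : (1 : ℝ) < 2))
      have := (summable_nat_add_iff 1).2 h
      simpa [Nat.cast_add, Nat.cast_one] using this
    have hs2 : Summable fun K : ℕ => (((K : ℝ) + 1) ^ (7 / 4 : ℝ))⁻¹ := by
      have h := (Real.summable_nat_rpow_inv.2 (by norm_num : (1 : ℝ) < 7 / 4))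
      have := (summable_nat_add_iff 1).2 h
      simpa [Nat.cast_add, Nat.cast_one] using this
    refine Summable.of_nonneg_of_le (fun K => mul_nonneg (by positivity) (add_nonneg zero_le_one Real.posLog_nonneg)) hterm
      (hs1.add (hs2.mul_left 8))
  · intro h
    have h' : Summable fun K : ℕ => (((K + 1 : ℕ) : ℝ))⁻¹ := by
      refine h.congr fun K => ?_
      rw [Real.sqrt_sq (by positivity)]
      simp
    exact Real.not_summable_natCast_inv ((summable_nat_add_iff (f := fun n : ℕ => ((n : ℝ))⁻¹) 1).1 h')

end Summability

end Summit.QuantumFields.YangMills.BalabanUVNodes.N19ExpectationCurrencyTwoConstantsAtScheme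

end
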